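import Summits.BirchSwinnertonDyer.BirchSwinnertonDyer.Theorems.EisensteinPrimesBSDpOnCellCTelescopeK2GlobalDefectInputs
import Summits.BirchSwinnertonDyer.BirchSwinnertonDyer.Theorems.ErratumRoadFiveLocalTorsionDegreeOne
import HarnessLib

/-!
# Crux 4 `BSDpOnCellC` (stmt-BirchSwinnertonDyer-19034), line `telescope`, leaf N2 `stub_weightTwoControl` (W2): the inputs
# (hfinK) / (hfin𝔮) of the coefficient-level weight control (`…TelescopeK2ControlOfCoefficients`) DISCHARGED on the SPLIT
# multiplicative branch — «the `Gal(K̄_𝔮/K_{∞,𝔮})`-fixed `c`-torsion of `A₂` is finite», and hence the `Gal(K̄/K_∞)`-fixed one,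
# from N1's (fd₀) quasi-isomorphism `A₂[c] → E[p^∞]` and the tree's (L1) `E(K_{∞,𝔮})[p^∞] = E(ℚ_p)[p^∞]`
# (helper, `--supports stmt-BirchSwinnertonDyer-19034 --as helper`; closes nothing)

Cell `bsd-eis`, width seat `bsd-line-x2-p2` (prover g19, 2026-08-29; D-0154 KEY row 5). THEOREMS ONLY: no definition, no named
fact, no `sorry`, no instance, no notation. Composes, BY NAME, this seat's `TelescopeK2GlobalDefectInputs.finite_fixed_torsionBy_of_addMonoidHom`
(p747415) with bsd-stepL's `LocalTorsionDegreeOne.exists_submodule_finite_of_fixed_primaryTorsion` (Tate uniformisation chain (L1):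
for `E/ℚ` SPLIT multiplicative at the odd `p`, `K_𝔮 = ℚ_p`, and a character `Γ_{K_𝔮} → ℤ_p` with open image, the fixed `p`-power torsion
of `E(K̄)` is finite) and `AnticyclotomicLocalImage.anticyclotomic_exists_forall_exists_toAdd_eq_pow_mul` (Brink: open image of the
anticyclotomic character on `Γ_{K_𝔮}`, `𝔮 ∣ p`).

* `finite_fixed_torsionBy_local_of_splitMult` — for ANY `𝒪`, any `ρ : Γ_K → Aut_𝒪(A)`, `c ∈ 𝒪` and an additive
  `θ₀ : A[c] → E_K[p^∞]` with FINITE KERNEL intertwining `BigGaloisRep.torsionRep ρ c` with `(W.baseChange K).primaryTorsionGaloisRep p`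
  (N1's (fd₀) at `c = X`; (fd_k)-type maps land in `A_{g_k}†` instead and are NOT covered here): at a degree-one `𝔮 ∋ p` where
  `κ ∘ res_{K_𝔮}` has image `⊇ p^s ℤ_p`, the set `{a ∈ A | c • a = 0, a fixed by every τ ∈ Γ_{K_𝔮} with κ(res τ) = 1}` is FINITE
  (= hypothesis (hfin𝔮) of `TelescopeK2ControlOfCoefficients.smul_mem_map_torsionInclH1_selmer_of_coefficients` /
  `exists_quotSMulTop_XBig_linearMap_of_coefficients`, and of `TelescopeK2GlobalDefectFinite.finite_quotSMulTop_invariants_restrict`).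
* `finite_fixed_torsionBy_global_of_local` — the `Gal(K̄/K_∞)`-fixed `c`-torsion is contained in the locally fixed one, hence FINITE
  too (= (hfinK) of `finite_ker_torsionInclH1_of_coefficients` / (hfin) of `finite_quotSMulTop_invariants_anticyclotomic`).
* `finite_fixed_torsionBy_local_anticyclotomic` / `finite_fixed_torsionBy_global_anticyclotomic` — `K` imaginary quadratic, `κ`
  anticyclotomic, `p` odd: the open image discharged (Brink Cor. 1, tree theorem).

HONEST FRAMING: assembly of tree theorems over binders; SPLIT multiplicative reduction at `p` is a hypothesis (Cell C also contains
non-split multiplicative pairs, not covered by the tree's (L1)); nothing about the branch lattice is asserted beyond the binder `θ₀`;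
BSD is proved for no pair; no registered stub, crux or summit statement is proved by this file; closes: none.

References: [Castella2018Erratum] Lemma 2.1, Remark (2) (p. 2); [SilvermanATAEC1994] Thm. V.5.3; [Brink2007] Cor. 1 (p. 2136);
[GreenbergLNM1716] §4, proof of Prop. 4.10 («`E(K_∞)_{tors}` finite»).
-/

noncomputable section

-- D-0017: single-problem summit, the namespace repeats the problem name by design.
set_option linter.dupNamespace false
set_option autoImplicit false

open Field IsDedekindDomain NumberField WeierstrassCurve
open Literature.NumberTheory.GaloisRepresentations Literature.NumberTheory.EllipticCurves
  Literature.NumberTheory.EllipticCurves.BigGaloisRep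

namespace Summit.BirchSwinnertonDyer.BirchSwinnertonDyer.Theorems.TelescopeK2FixedTorsionFiniteSplitMult

variable {K : Type} [Field K] [NumberField K] {p : ℕ} [Fact p.Prime] (W : WeierstrassCurve ℚ) [W.IsElliptic]
  {𝒪 : Type*} [CommRing 𝒪] [TopologicalSpace 𝒪]
  {A : Type} [AddCommGroup A] [Module 𝒪 A] [TopologicalSpace A]
  (κ : ZpExtension K p) (ρ : ContinuousRep (absoluteGaloisGroup K) 𝒪 A) (c : 𝒪)
  (θ₀ : Submodule.torsionBy 𝒪 A c →+ PrimaryTorsion (geomPoints (W.baseChange K)) p)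

/-- **(hfin𝔮) on the split multiplicative branch.** `p` odd, `E = W/ℚ` SPLIT multiplicative at `p`, `𝔮 ∋ p` a degree-one prime of the
number field `K`, `κ` a `ℤ_p`-extension of `K` with `κ(res Γ_{K_𝔮}) ⊇ p^s ℤ_p`, and `θ₀ : A[c] → E_K[p^∞]` additive with finite kernel,
`Γ_K`-equivariant for `ρ` on `A[c]`: then `{a ∈ A : c • a = 0, ρ(res τ) a = a for all τ ∈ Γ_{K_𝔮} with κ(res τ) = 1}` is FINITE.
[cite: Castella2018Erratum, Lemma 2.1 and Remark (2) (p. 2)] [cite: SilvermanATAEC1994, Thm. V.5.3] -/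
theorem finite_fixed_torsionBy_local_of_splitMult (hp2 : p ≠ 2) (hsplit : W.HasSplitMultiplicativeReductionAtPrime p)
    (𝔮 : HeightOneSpectrum (𝓞 K)) (h𝔮 : ((p : ℕ) : 𝓞 K) ∈ 𝔮.asIdeal)
    (he : 𝔮.asIdeal.ramificationIdx (𝓞 ℚ) = 1) (hf : 𝔮.asIdeal.inertiaDeg (𝓞 ℚ) = 1) {s : ℕ}
    (hsurj : ∀ y : ℤ_[p], ∃ τ : LocalGroup K (Sum.inl 𝔮), (κ (localMap K (Sum.inl 𝔮) τ)).toAdd = (p : ℤ_[p]) ^ s * y)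
    (hθ : ∀ (σ : absoluteGaloisGroup K) (a : Submodule.torsionBy 𝒪 A c),
      θ₀ (BigGaloisRep.torsionRep ρ c σ a) = (W.baseChange K).primaryTorsionGaloisRep p σ (θ₀ a))
    (hker : Finite θ₀.ker) :
    Set.Finite {a : A | c • a = 0 ∧ ∀ τ : LocalGroup K (Sum.inl 𝔮),
      κ (localMap K (Sum.inl 𝔮) τ) = 1 → ρ (localMap K (Sum.inl 𝔮) τ) a = a} := by
  haveI : CharZero (𝔮.adicCompletion K) :=
    charZero_of_injective_algebraMap (algebraMap K (𝔮.adicCompletion K)).injective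
  obtain ⟨φ⟩ := LocalTorsionDegreeOne.nonempty_padic_ringEquiv_adicCompletion p K 𝔮 h𝔮 he hf
  let f : absoluteGaloisGroup (𝔮.adicCompletion K) →ₜ* Multiplicative ℤ_[p] :=
    κ.toContinuousMonoidHom.comp (absGaloisRestrict K (𝔮.adicCompletion K))
  have hsurjf : ∀ y : ℤ_[p], ∃ τ : absoluteGaloisGroup (𝔮.adicCompletion K), (f τ).toAdd = (p : ℤ_[p]) ^ s * y := hsurj
  obtain ⟨k, A₀, hA₀fin, -, hA₀, -⟩ :=
    LocalTorsionDegreeOne.exists_submodule_finite_of_fixed_primaryTorsion W K (𝔮.adicCompletion K) hp2 hsplit φ f hsurjf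
  haveI := hA₀fin
  -- the (fd₀) transport of p747415, along `res = localMap K (Sum.inl 𝔮)`
  refine TelescopeK2GlobalDefectInputs.finite_fixed_torsionBy_of_addMonoidHom
    (κ.toContinuousMonoidHom.comp (localMap K (Sum.inl 𝔮))) (ρ.restrict (localMap K (Sum.inl 𝔮))) c
    (fun τ e => (W.baseChange K).primaryTorsionGaloisRep p (localMap K (Sum.inl 𝔮) τ) e) θ₀
    (fun τ a => ?_) hker ?_
  · -- equivariance along the restriction
    have h := hθ (localMap K (Sum.inl 𝔮) τ) a
    have heq : BigGaloisRep.torsionRep (ρ.restrict (localMap K (Sum.inl 𝔮))) c τ a =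
        BigGaloisRep.torsionRep ρ c (localMap K (Sum.inl 𝔮) τ) a := Subtype.ext rfl
    rw [heq]
    exact h
  · -- the fixed vectors of `E_K[p^∞]` lie in the finite `A₀`
    refine (Set.finite_coe_iff.mp (inferInstance : Finite A₀)).subset fun e he => ?_
    exact hA₀ e fun h hh => by
      have h1 := he h hh
      rw [primaryTorsionGaloisRep_apply] at h1
      exact h1

/-- **(hfinK) from (hfin𝔮)**: a vector fixed by `Gal(K̄/K_∞) = ker κ` is fixed by `res(ker (κ ∘ res))`, so the globally fixed
`c`-torsion is finite when the locally fixed one is. [cite: GreenbergLNM1716, §4, proof of Prop. 4.10] [folklore] -/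
theorem finite_fixed_torsionBy_global_of_local (𝔮 : HeightOneSpectrum (𝓞 K))
    (hloc : Set.Finite {a : A | c • a = 0 ∧ ∀ τ : LocalGroup K (Sum.inl 𝔮),
      κ (localMap K (Sum.inl 𝔮) τ) = 1 → ρ (localMap K (Sum.inl 𝔮) τ) a = a}) :
    Set.Finite {a : A | c • a = 0 ∧ ∀ g : absoluteGaloisGroup K, κ g = 1 → ρ g a = a} :=
  hloc.subset fun _ ha => ⟨ha.1, fun _ hτ => ha.2 _ hτ⟩

/-- **(hfin𝔮) on the anticyclotomic tower** (`K` imaginary quadratic, `κ` anticyclotomic, `p` odd: the open image on `Γ_{K_𝔮}` is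
the tree's `AnticyclotomicLocalImage.anticyclotomic_exists_forall_exists_toAdd_eq_pow_mul`). [cite: Brink2007, Cor. 1 (p. 2136)]
[cite: Castella2018Erratum, Lemma 2.1 and Remark (2) (p. 2)] -/
theorem finite_fixed_torsionBy_local_anticyclotomic (hK : IsImaginaryQuadratic K) (hp2 : p ≠ 2)
    (hsplit : W.HasSplitMultiplicativeReductionAtPrime p) (hκ : κ.IsAnticyclotomic)
    (𝔮 : HeightOneSpectrum (𝓞 K)) (h𝔮 : ((p : ℕ) : 𝓞 K) ∈ 𝔮.asIdeal)
    (he : 𝔮.asIdeal.ramificationIdx (𝓞 ℚ) = 1) (hf : 𝔮.asIdeal.inertiaDeg (𝓞 ℚ) = 1)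
    (hθ : ∀ (σ : absoluteGaloisGroup K) (a : Submodule.torsionBy 𝒪 A c),
      θ₀ (BigGaloisRep.torsionRep ρ c σ a) = (W.baseChange K).primaryTorsionGaloisRep p σ (θ₀ a))
    (hker : Finite θ₀.ker) :
    Set.Finite {a : A | c • a = 0 ∧ ∀ τ : LocalGroup K (Sum.inl 𝔮),
      κ (localMap K (Sum.inl 𝔮) τ) = 1 → ρ (localMap K (Sum.inl 𝔮) τ) a = a} := by
  obtain ⟨s, hsurj⟩ := AnticyclotomicLocalImage.anticyclotomic_exists_forall_exists_toAdd_eq_pow_mul hK hp2 κ hκ 𝔮 h𝔮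
  exact finite_fixed_torsionBy_local_of_splitMult W κ ρ c θ₀ hp2 hsplit 𝔮 h𝔮 he hf hsurj hθ hker

/-- **(hfinK) on the anticyclotomic tower**: the `Gal(K̄/K_∞)`-fixed `c`-torsion of `A` is finite (same hypotheses; any degree-one
`𝔮 ∣ p` serves). [cite: Brink2007, Cor. 1 (p. 2136)] [cite: GreenbergLNM1716, §4, proof of Prop. 4.10] -/
theorem finite_fixed_torsionBy_global_anticyclotomic (hK : IsImaginaryQuadratic K) (hp2 : p ≠ 2)
    (hsplit : W.HasSplitMultiplicativeReductionAtPrime p) (hκ : κ.IsAnticyclotomic)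
    (𝔮 : HeightOneSpectrum (𝓞 K)) (h𝔮 : ((p : ℕ) : 𝓞 K) ∈ 𝔮.asIdeal)
    (he : 𝔮.asIdeal.ramificationIdx (𝓞 ℚ) = 1) (hf : 𝔮.asIdeal.inertiaDeg (𝓞 ℚ) = 1)
    (hθ : ∀ (σ : absoluteGaloisGroup K) (a : Submodule.torsionBy 𝒪 A c),
      θ₀ (BigGaloisRep.torsionRep ρ c σ a) = (W.baseChange K).primaryTorsionGaloisRep p σ (θ₀ a))
    (hker : Finite θ₀.ker) :
    Set.Finite {a : A | c • a = 0 ∧ ∀ g : absoluteGaloisGroup K, κ g = 1 → ρ g a = a} :=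
  finite_fixed_torsionBy_global_of_local κ ρ c 𝔮
    (finite_fixed_torsionBy_local_anticyclotomic W κ ρ c θ₀ hK hp2 hsplit hκ 𝔮 h𝔮 he hf hθ hker)

end Summit.BirchSwinnertonDyer.BirchSwinnertonDyer.Theorems.TelescopeK2FixedTorsionFiniteSplitMult

end
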